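import Summits.CriticalPhenomena.SAWScalingLimit.Theorems.SAWLeftRightFKGFKGToTraversalBoundSlitNecklaceDefs
import Summits.CriticalPhenomena.SAWScalingLimit.Theorems.FKGToTraversalBound.Negative.R1Split
import Mathlib.Combinatorics.Pigeonhole
import Mathlib.Analysis.SpecialFunctions.Trigonometric.Bounds
import Mathlib.Analysis.SpecialFunctions.Complex.Arg
import Mathlib.Analysis.SpecialFunctions.Pow.Real
import HarnessLib

/-!
# (H1) for one approximation gives per-shell EVENTUAL tightness (stubs `hasTraversals_circle_cover`,
`eventualShellTight_of_h1At`)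

Crux `SAWLeftRightFKG.FKGToTraversalBound` (stmt-CriticalPhenomena-1878), line `slit-necklace`, registered stubs
`hasTraversals_circle_cover` (geometric engine) and `eventualShellTight_of_h1At` (the CONVERSE of the landed
`stub_eventualShellReduction`, `Theorems/SAWLeftRightFKGFKGToTraversalBoundEventualShellReduction.lean`): for one
endpoint approximation `(D, a, b)`, the body `H1At D a b` of `SAWTraversalBound` (a bound `K (ρ/R)^λ`, `λ > 2`, on
the probability of `k(x, ρ, R)` separate traversals of EVERY shell `D(x; ρ, R)`, `δ ≤ ρ < R ≤ 1`) implies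
`EventualShellTight D a b` (for every FIXED shell of modulus `≥ 2` and every `ε > 0` some threshold `n` has
`P_δ(n separate traversals) ≤ ε` eventually as `δ → 0⁺`).  Together with the landed direction the two are
equivalent, so the route child `GermTightness` is implied by (H1) (lead's corollary file).

**Mathematics.**  (H1) bounds only a FIXED number `k(x, ρ, R)` of traversals of a shell, by the fixed number
`K (ρ/R)^λ`; to reach an arbitrary `ε` one covers the middle circle of the shell by MANY SMALL shells and uses
`λ > 2 > 1`.

* `hasTraversals_circle_cover` (deterministic geometry of curves in `ℂ`).  Let `m = (ρ + R)/2` and let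
  `y_j = x + m e^{2πi j/N}`, `j < N`, be equally spaced on the middle circle, `2πm ≤ N r`.  Every point `z` with
  `dist z x = m` is within `r` of some `y_j`: `z - x = m e^{iθ}` (polar form, `Complex.norm_mul_exp_arg_mul_I`),
  the integer `j₀ = ⌊θN/2π⌋` reduced mod `N` gives the same point `e^{2πi j₀/N}` (periodicity), and chord ≤ arc:
  `‖e^{iθ} - e^{iθ'}‖ = ‖e^{i(θ-θ')} - 1‖ ≤ |θ - θ'| ≤ 2π/N` (`Real.norm_exp_I_mul_ofReal_sub_one_le`).  On each of
  `n ≥ N q` separate traversals `γ|[sᵢ, tᵢ]` of `D(x; ρ, R)` the continuous `u ↦ dist (γ u) x` passes through `m`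
  at some `τᵢ ∈ [sᵢ, tᵢ]` (intermediate value theorem on `unitInterval`); with `dist (γ τᵢ) y_{j(i)} ≤ r` the
  segment `[τᵢ, tᵢ]` traverses `D(y_{j(i)}; r, (R - ρ)/2)` in either orientation (`dist (γ tᵢ) y ≥
  |dist (γ tᵢ) x - m| ≥ (R - ρ)/2` since `dist y x = m` exactly).  Pigeonhole on `i ↦ j(i)`
  (`Fintype.exists_le_card_fiber_of_mul_le_card`) and increasing enumeration of a fibre of size `q`
  (`Finset.orderEmbOfFin`); sub-intervals of separated intervals are separated.  (Pattern of the landed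
  `hasTraversals_subshell_pigeonhole`, p129366, which only produces modulus-`2` shells.)
* `eventualShellTight_of_h1At`.  Fix the shell (`0 < ρ`, `2ρ ≤ R ≤ 1`), `ε > 0`, and `k, K, λ, δ₀` from (H1).
  With `R' = (R - ρ)/2 ∈ (0, 1/2]`, a radius `0 < r ≤ min(R', 1)/2` and `N = ⌈2πm/r⌉₊ + 1` the circle cover and
  `HasTraversals.of_le` give `{N q traversals of D(x; ρ, R)} ⊆ ⋃_j {k(y_j, r, R') traversals of D(y_j; r, R')}`
  for `q = max_j k(y_j, r, R')`, so for `δ ≤ min(δ₀, r)` the union bound and (H1) on each small shell give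
  `law ≤ N · K (r/R')^λ ≤ (2πm/r + 2) K (r/R')² ≤ C r`, `C = K (2πm + 2)/R'²` (`(r/R')^λ ≤ (r/R')²` as
  `r/R' ≤ 1 < 2 < λ`).  Choosing `r` with `C r < ε` (a limit `r → 0⁺`, extracted from the filter `𝓝[>] 0`)
  finishes, with threshold `n = N q` and the germ `Ioo 0 (min δ₀ r)`.

No named literature fact; axioms are the standard three.
-/

noncomputable section

open MeasureTheory Filter Topology Set Metric
open scoped NNReal ENNReal
open Literature.Probability.LatticeModels
open Literature.Probability.RandomPlanarGeometry
open Literature.Probability.RandomPlanarGeometry.SAW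
open Summit.CriticalPhenomena.SAWScalingLimit.Theorems.FKGToTraversalBound.Negative (H1At)

namespace Summit.CriticalPhenomena.SAWScalingLimit.Theorems.FKGToTraversalBound.SlitNecklace

/-! ### Sphere-cover pigeonhole in a pseudo-metric space -/

/-- **One segment.**  If the centres `cᵢ` lie ON the middle sphere `{dist · x = (ρ + R)/2}` of the shell
`D(x; ρ, R)` (`ρ < R`) and every point of that sphere is within `r` of some `cᵢ`, then a traversal `γ|[a, b]`
of `D(x; ρ, R)` contains a traversal `γ|[a', b]`, `a ≤ a'`, of `D(cᵢ; r, (R - ρ)/2)` for some `i`: cut at a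
time `a'` where `dist (γ a') x = (ρ + R)/2` (intermediate value theorem); the endpoint `γ b` is at distance
`≥ (R - ρ)/2` from `cᵢ` in either orientation (triangle inequality through `x`). [folklore] -/
private theorem circleCover_refine {E : Type*} [PseudoMetricSpace E] (γ : Curve E) (x : E)
    {ρ R r : ℝ} {N : ℕ} (c : Fin N → E) (hρR : ρ < R) (hc : ∀ i, dist (c i) x = (ρ + R) / 2)
    (hcov : ∀ z : E, dist z x = (ρ + R) / 2 → ∃ i : Fin N, dist z (c i) ≤ r) {a b : unitInterval}
    (h : γ.IsTraversal x ρ R a b) :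
    ∃ i : Fin N, ∃ a' : unitInterval, a ≤ a' ∧ γ.IsTraversal (c i) r ((R - ρ) / 2) a' b := by
  have hgc : Continuous fun u : unitInterval ↦ dist (γ u) x := γ.continuous.dist continuous_const
  rcases h.2 with ⟨ha, hb⟩ | ⟨ha, hb⟩
  · -- `γ a` is close to `x`, `γ b` is far
    obtain ⟨θ, hθ, hgθ⟩ := intermediate_value_Icc (f := fun u : unitInterval ↦ dist (γ u) x) h.1
      hgc.continuousOn ⟨(by linarith : dist (γ a) x ≤ (ρ + R) / 2),
        (by linarith : (ρ + R) / 2 ≤ dist (γ b) x)⟩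
    have hgθ' : dist (γ θ) x = (ρ + R) / 2 := hgθ
    obtain ⟨i, hi⟩ := hcov (γ θ) hgθ'
    refine ⟨i, θ, hθ.1, hθ.2, Or.inl ⟨hi, ?_⟩⟩
    have h1 := dist_triangle (γ b) (c i) x
    rw [hc i] at h1
    linarith
  · -- `γ a` is far from `x`, `γ b` is close
    obtain ⟨θ, hθ, hgθ⟩ := intermediate_value_Icc' (f := fun u : unitInterval ↦ dist (γ u) x) h.1
      hgc.continuousOn ⟨(by linarith : dist (γ b) x ≤ (ρ + R) / 2),
        (by linarith : (ρ + R) / 2 ≤ dist (γ a) x)⟩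
    have hgθ' : dist (γ θ) x = (ρ + R) / 2 := hgθ
    obtain ⟨i, hi⟩ := hcov (γ θ) hgθ'
    refine ⟨i, θ, hθ.1, hθ.2, Or.inl ⟨hi, ?_⟩⟩
    have h1 := dist_triangle (c i) (γ b) x
    rw [hc i, dist_comm (c i) (γ b)] at h1
    linarith

/-- **Sphere-cover pigeonhole.**  With centres `cᵢ`, `i < N`, `0 < N`, on the middle sphere of `D(x; ρ, R)`
(`ρ < R`) forming an `r`-net of that sphere, `n ≥ N q` separate traversals of `D(x; ρ, R)` yield `q` separate
traversals of one of the shells `D(cᵢ; r, (R - ρ)/2)` (refine each segment by `circleCover_refine`, pigeonhole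
on the centres, enumerate a fibre increasingly). [folklore] -/
private theorem circleCover_pigeonhole {E : Type*} [PseudoMetricSpace E] (γ : Curve E) (x : E)
    {ρ R r : ℝ} {N n q : ℕ} (c : Fin N → E) (hρR : ρ < R) (hN : 0 < N) (hn : N * q ≤ n)
    (hc : ∀ i, dist (c i) x = (ρ + R) / 2)
    (hcov : ∀ z : E, dist z x = (ρ + R) / 2 → ∃ i : Fin N, dist z (c i) ≤ r)
    (htrav : γ.HasTraversals n x ρ R) : ∃ i : Fin N, γ.HasTraversals q (c i) r ((R - ρ) / 2) := by
  haveI : Nonempty (Fin N) := ⟨⟨0, hN⟩⟩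
  obtain ⟨p, t, hpt, hsep⟩ := htrav.of_le hn
  choose idx a ha hat using fun m ↦ circleCover_refine γ x c hρR hc hcov (hpt m)
  obtain ⟨y, hy⟩ := Fintype.exists_le_card_fiber_of_mul_le_card (f := idx) (n := q)
    (by simp only [Fintype.card_fin, le_refl])
  obtain ⟨F, hF, hcard⟩ := Finset.exists_subset_card_eq hy
  have hidx : ∀ j : Fin q, idx (F.orderEmbOfFin hcard j) = y := fun j ↦ by
    simpa using hF (F.orderEmbOfFin_mem hcard j)
  refine ⟨y, fun j ↦ a (F.orderEmbOfFin hcard j), fun j ↦ t (F.orderEmbOfFin hcard j),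
    fun j ↦ ?_, fun j j' hjj' ↦ ?_⟩
  · have := hat (F.orderEmbOfFin hcard j)
    rwa [hidx j] at this
  · calc t (F.orderEmbOfFin hcard j) < p (F.orderEmbOfFin hcard j') :=
          hsep ((F.orderEmbOfFin hcard).strictMono hjj')
      _ ≤ a (F.orderEmbOfFin hcard j') := ha _

/-! ### Equally spaced points on a circle -/

/-- **Chord ≤ arc on the unit circle.**  For `0 < N` and every angle `θ`, one of the `N` equally spaced points
`e^{2πi j/N}`, `j < N`, is within `2π/N` of `e^{iθ}`: take `j = ⌊θN/2π⌋ mod N` (periodicity of `exp`) and use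
`‖e^{it} - 1‖ ≤ |t|`. [folklore] -/
private theorem circleCover_net {N : ℕ} (hN : 0 < N) (θ : ℝ) :
    ∃ j : Fin N, ‖Complex.exp (θ * Complex.I) -
      Complex.exp (2 * Real.pi * Complex.I * ((j : ℕ) / (N : ℂ)))‖ ≤ 2 * Real.pi / N := by
  have hN' : (0 : ℝ) < N := by exact_mod_cast hN
  have hNz : (0 : ℤ) < N := by exact_mod_cast hN
  have hNc : (N : ℂ) ≠ 0 := by exact_mod_cast hN.ne'
  have hπ : 0 < Real.pi := Real.pi_pos
  set j₀ : ℤ := ⌊θ * N / (2 * Real.pi)⌋ with hj₀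
  set jz : ℤ := j₀ % (N : ℤ) with hjz
  have hjz0 : 0 ≤ jz := Int.emod_nonneg _ hNz.ne'
  have hjzN : jz < N := Int.emod_lt_of_pos _ hNz
  refine ⟨⟨jz.toNat, (Int.toNat_lt hjz0).2 hjzN⟩, ?_⟩
  set φ : ℝ := 2 * Real.pi * j₀ / N with hφ
  -- the net point is `e^{iφ}`
  have hexp : Complex.exp (2 * Real.pi * Complex.I * (((jz.toNat : ℕ) : ℂ) / (N : ℂ))) =
      Complex.exp (φ * Complex.I) := by
    have h1 : ((jz.toNat : ℕ) : ℂ) = ((jz : ℤ) : ℂ) := by exact_mod_cast Int.toNat_of_nonneg hjz0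
    have h2 : (jz : ℂ) = (j₀ : ℂ) - (N : ℂ) * ((j₀ / N : ℤ) : ℂ) := by
      rw [hjz, Int.emod_def]
      push_cast
      ring
    have h3 : 2 * Real.pi * Complex.I * (((j₀ : ℂ) - (N : ℂ) * ((j₀ / N : ℤ) : ℂ)) / (N : ℂ)) =
        (φ : ℂ) * Complex.I - ((j₀ / N : ℤ) : ℂ) * (2 * Real.pi * Complex.I) := by
      rw [sub_div, mul_div_cancel_left₀ _ hNc, mul_sub, hφ]
      push_cast
      ring
    rw [h1, h2, h3, Complex.exp_sub, Complex.exp_int_mul_two_pi_mul_I, div_one]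
  -- chord ≤ arc
  have hdiff : ‖Complex.exp (θ * Complex.I) - Complex.exp (φ * Complex.I)‖ ≤ |θ - φ| := by
    have key : Complex.exp (θ * Complex.I) =
        Complex.exp (φ * Complex.I) * Complex.exp (Complex.I * ((θ - φ : ℝ) : ℂ)) := by
      rw [← Complex.exp_add]
      congr 1
      push_cast
      ring
    rw [key, ← mul_sub_one, norm_mul, Complex.norm_exp_ofReal_mul_I, one_mul]
    exact Real.norm_exp_I_mul_ofReal_sub_one_le.trans_eq (Real.norm_eq_abs _)
  -- the angle gap
  have hθφ : |θ - φ| ≤ 2 * Real.pi / N := by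
    have hfl := Int.floor_le (θ * N / (2 * Real.pi))
    have hfl' := Int.lt_floor_add_one (θ * N / (2 * Real.pi))
    rw [← hj₀] at hfl hfl'
    have key : θ - φ = 2 * Real.pi / N * (θ * N / (2 * Real.pi) - j₀) := by
      rw [hφ]
      field_simp
    have h0 : 0 ≤ θ * N / (2 * Real.pi) - j₀ := by linarith
    have h1 : θ * N / (2 * Real.pi) - j₀ ≤ 1 := by linarith
    have hc : 0 < 2 * Real.pi / N := by positivity
    rw [key, abs_of_nonneg (mul_nonneg hc.le h0)]
    calc 2 * Real.pi / N * (θ * N / (2 * Real.pi) - j₀) ≤ 2 * Real.pi / N * 1 :=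
          mul_le_mul_of_nonneg_left h1 hc.le
      _ = 2 * Real.pi / N := mul_one _
  change ‖Complex.exp (θ * Complex.I) -
    Complex.exp (2 * Real.pi * Complex.I * (((jz.toNat : ℕ) : ℂ) / (N : ℂ)))‖ ≤ 2 * Real.pi / N
  rw [hexp]
  exact hdiff.trans hθφ

/-- **Registered stub `hasTraversals_circle_cover`** (crux stmt-CriticalPhenomena-1878, line `slit-necklace`):
**circle-cover pigeonhole.**  Let `D(x; ρ, R)` be a shell of `ℂ` (`0 < ρ < R`), `m = (ρ + R)/2` its middle
radius, `r > 0`, and `N > 0` with `2πm ≤ N r`, so that the `N` equally spaced points `y_j = x + m e^{2πi j/N}`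
of the middle circle form an `r`-net of it (chord ≤ arc).  If the curve `γ` makes `n ≥ N q` separate traversals
of `D(x; ρ, R)`, then it makes `q` separate traversals of one of the shells `D(y_j; r, (R - ρ)/2)`: each
traversal is cut where `dist (γ ·) x = m` (intermediate value theorem) and assigned to a point `y_j` within `r`
of the cut; the far endpoint is at distance `≥ (R - ρ)/2` from `y_j`; pigeonhole on `j`. [folklore] -/
theorem hasTraversals_circle_cover : ∀ (γ : Curve ℂ) (x : ℂ) (ρ R r : ℝ) (N n q : ℕ), 0 < ρ → ρ < R → 0 < r → 2 * Real.pi * ((ρ + R) / 2) ≤ N * r → 0 < N → N * q ≤ n → γ.HasTraversals n x ρ R → ∃ j : Fin N, γ.HasTraversals q (x + (((ρ + R) / 2 : ℝ) : ℂ) * Complex.exp (2 * Real.pi * Complex.I * ((j : ℕ) / (N : ℂ)))) r ((R - ρ) / 2) := by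
  intro γ x ρ R r N n q hρ hρR hr hNr hN hn htrav
  have hN' : (0 : ℝ) < N := by exact_mod_cast hN
  set m : ℝ := (ρ + R) / 2 with hm
  have hm0 : 0 < m := by linarith
  set c : Fin N → ℂ := fun j ↦
    x + (m : ℂ) * Complex.exp (2 * Real.pi * Complex.I * ((j : ℕ) / (N : ℂ))) with hc
  -- the norm of a point of the unit circle
  have hunit : ∀ j : Fin N, ‖Complex.exp (2 * Real.pi * Complex.I * ((j : ℕ) / (N : ℂ)))‖ = 1 := by
    intro j
    have : 2 * Real.pi * Complex.I * ((j : ℕ) / (N : ℂ)) =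
        ((2 * Real.pi * (j : ℕ) / (N : ℝ) : ℝ) : ℂ) * Complex.I := by
      push_cast
      ring
    rw [this, Complex.norm_exp_ofReal_mul_I]
  -- the centres lie on the middle circle
  have hcx : ∀ j, dist (c j) x = m := by
    intro j
    change dist (x + (m : ℂ) * Complex.exp (2 * Real.pi * Complex.I * ((j : ℕ) / (N : ℂ)))) x = m
    rw [dist_eq_norm, add_sub_cancel_left, norm_mul, Complex.norm_real, Real.norm_eq_abs,
      abs_of_pos hm0, hunit j, mul_one]
  -- the centres form an `r`-net of the middle circle
  have hcov : ∀ z : ℂ, dist z x = m → ∃ j : Fin N, dist z (c j) ≤ r := by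
    intro z hz
    have hzx : ‖z - x‖ = m := by rwa [← dist_eq_norm]
    have hpolar : z - x = (m : ℂ) * Complex.exp ((Complex.arg (z - x) : ℂ) * Complex.I) := by
      have := Complex.norm_mul_exp_arg_mul_I (z - x)
      rw [hzx] at this
      exact this.symm
    obtain ⟨j, hj⟩ := circleCover_net hN (Complex.arg (z - x))
    refine ⟨j, ?_⟩
    have hzc : z - c j = (m : ℂ) * (Complex.exp ((Complex.arg (z - x) : ℂ) * Complex.I) -
        Complex.exp (2 * Real.pi * Complex.I * ((j : ℕ) / (N : ℂ)))) := by
      rw [mul_sub, ← hpolar]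
      simp only [hc]
      ring
    rw [dist_eq_norm, hzc, norm_mul, Complex.norm_real, Real.norm_eq_abs, abs_of_pos hm0]
    calc m * ‖Complex.exp ((Complex.arg (z - x) : ℂ) * Complex.I) -
          Complex.exp (2 * Real.pi * Complex.I * ((j : ℕ) / (N : ℂ)))‖ ≤ m * (2 * Real.pi / N) :=
          mul_le_mul_of_nonneg_left hj hm0.le
      _ = 2 * Real.pi * m / N := by ring
      _ ≤ r := by
          rw [div_le_iff₀ hN']
          linarith
  exact circleCover_pigeonhole γ x c hρR hN hn hcx hcov htrav

/-! ### The consequence: (H1) ⇒ per-shell eventual tightness -/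

/-- **Registered stub `eventualShellTight_of_h1At`** (crux stmt-CriticalPhenomena-1878, line `slit-necklace`):
**(H1) for one endpoint approximation implies per-shell EVENTUAL tightness** — the converse of the landed
`stub_eventualShellReduction`.  For a fixed shell `D(x; ρ, R)` (`0 < ρ`, `2ρ ≤ R ≤ 1`) and `ε > 0`: cover its
middle circle by `N = ⌈2πm/r⌉₊ + 1` shells `D(y_j; r, (R - ρ)/2)` of small inner radius `r`
(`hasTraversals_circle_cover`), bound each by (H1) for meshes `δ < min(δ₀, r)` and sum:
`N · K (2r/(R - ρ))^λ ≤ (2πm/r + 2) K (2r/(R - ρ))² ≤ C r < ε` for `r` small, since `λ > 2` and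
`2r/(R - ρ) ≤ 1`; the threshold is `n = N · max_j k(y_j, r, (R - ρ)/2)`. [folklore] -/
theorem eventualShellTight_of_h1At : ∀ (D : DobrushinDomain) (a b : ℝ → Site 2), H1At D a b → EventualShellTight D a b := by
  intro D a b h x ρ R hρ h2 hR1 ε hε
  obtain ⟨k, K, lam, δ₀, hK, hlam, hδ₀, hH⟩ := h
  -- geometry of the shell
  have hρR : ρ < R := by linarith
  set m : ℝ := (ρ + R) / 2 with hm
  set R' : ℝ := (R - ρ) / 2 with hR'
  have hm0 : 0 < m := by linarith
  have hR'0 : 0 < R' := by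
    rw [hR']
    linarith
  have hR'1 : R' ≤ 1 := by
    rw [hR']
    linarith
  -- the constant of the final bound `law ≤ C r`
  set C : ℝ := K * (2 * Real.pi * m + 2) / R' ^ 2 with hC
  -- choice of the small inner radius `r`
  have hev₁ : ∀ᶠ r in 𝓝[>] (0 : ℝ), C * r < ε := by
    have ht : Tendsto (fun r : ℝ => C * r) (𝓝 0) (𝓝 (C * 0)) := tendsto_const_nhds.mul tendsto_id
    rw [mul_zero] at ht
    exact (ht.mono_left nhdsWithin_le_nhds).eventually_lt_const hε
  have hev₂ : ∀ᶠ r in 𝓝[>] (0 : ℝ), r ∈ Ioo 0 (min R' 1 / 2) := Ioo_mem_nhdsGT (by positivity)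
  obtain ⟨r, hr₁, hr0, hr₂⟩ := (hev₁.and hev₂).exists
  have hrR' : r < R' := by
    have := min_le_left R' 1
    linarith
  have hr1 : r ≤ 1 := by
    have := min_le_right R' 1
    linarith
  have hrdiv : r / R' ≤ 1 := by
    rw [div_le_one hR'0]
    exact hrR'.le
  -- the number of small shells
  set N : ℕ := ⌈2 * Real.pi * m / r⌉₊ + 1 with hN
  have hN0 : 0 < N := Nat.succ_pos _
  have hN' : (0 : ℝ) < N := by exact_mod_cast hN0
  have hNr : 2 * Real.pi * m ≤ N * r := by
    have h1 := Nat.le_ceil (2 * Real.pi * m / r)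
    rw [div_le_iff₀ hr0] at h1
    rw [hN]
    push_cast
    nlinarith
  have hNle : (N : ℝ) ≤ 2 * Real.pi * m / r + 2 := by
    have h1 := Nat.ceil_lt_add_one (show 0 ≤ 2 * Real.pi * m / r by positivity)
    rw [hN]
    push_cast
    linarith
  -- the centres and the threshold
  set c : Fin N → ℂ := fun j ↦
    x + (m : ℂ) * Complex.exp (2 * Real.pi * Complex.I * ((j : ℕ) / (N : ℂ))) with hc
  set q : ℕ := Finset.univ.sup fun j : Fin N => k (c j) r R' with hq
  have hkq : ∀ j : Fin N, k (c j) r R' ≤ q := fun j =>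
    Finset.le_sup (f := fun j : Fin N => k (c j) r R') (Finset.mem_univ j)
  -- the real bound
  have hpow : (r / R') ^ lam ≤ (r / R') ^ 2 := by
    have h1 := Real.rpow_le_rpow_of_exponent_ge (by positivity : 0 < r / R') hrdiv hlam.le
    rwa [Real.rpow_two] at h1
  have hbound : (N : ℝ) * (K * (r / R') ^ lam) ≤ ε := by
    have h1 : (N : ℝ) * (K * (r / R') ^ lam) ≤ (2 * Real.pi * m / r + 2) * (K * (r / R') ^ 2) :=
      mul_le_mul hNle (mul_le_mul_of_nonneg_left hpow hK) (by positivity) (by positivity)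
    have h2 : (2 * Real.pi * m / r + 2) * (K * (r / R') ^ 2) =
        K * (2 * Real.pi * m * r + 2 * r ^ 2) / R' ^ 2 := by
      field_simp
    have h3 : K * (2 * Real.pi * m * r + 2 * r ^ 2) / R' ^ 2 ≤ C * r := by
      rw [hC, div_mul_eq_mul_div]
      apply div_le_div_of_nonneg_right _ (by positivity)
      have h4 : 2 * Real.pi * m * r + 2 * r ^ 2 ≤ (2 * Real.pi * m + 2) * r := by nlinarith
      nlinarith
    linarith
  refine ⟨N * q, ?_⟩
  -- the germ of small meshes
  have hevδ : ∀ᶠ δ in 𝓝[>] (0 : ℝ), δ ∈ Ioo 0 (min δ₀ r) := Ioo_mem_nhdsGT (lt_min hδ₀ hr0)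
  filter_upwards [hevδ] with δ hδ
  obtain ⟨hδ0, hδlt⟩ := hδ
  have hδδ₀ : δ ∈ Set.Ioc 0 δ₀ := ⟨hδ0, hδlt.le.trans (min_le_left _ _)⟩
  have hδr : δ ≤ r := hδlt.le.trans (min_le_right _ _)
  -- Step 1: the circle cover
  set A : Fin N → Set (DomainSAW D.carrier δ (a δ) (b δ)) := fun j =>
    {γ | (polyline γ).HasTraversals (k (c j) r R') (c j) r R'} with hA
  have hsub : {γ : DomainSAW D.carrier δ (a δ) (b δ) | (polyline γ).HasTraversals (N * q) x ρ R} ⊆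
      ⋃ j : Fin N, A j := by
    intro γ hγ
    obtain ⟨j, hj⟩ :=
      hasTraversals_circle_cover (polyline γ) x ρ R r N (N * q) q hρ hρR hr0 hNr hN0 le_rfl hγ
    exact mem_iUnion.2 ⟨j, hj.of_le (hkq j)⟩
  -- Step 2: (H1) on each small shell
  have hH1j : ∀ j : Fin N, law D.carrier δ (a δ) (b δ) (A j) ≤ ENNReal.ofReal (K * (r / R') ^ lam) :=
    fun j => hH δ hδδ₀ (c j) r R' hδr hrR' hR'1
  -- Step 3: the union bound
  calc law D.carrier δ (a δ) (b δ) {γ | (polyline γ).HasTraversals (N * q) x ρ R}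
      ≤ law D.carrier δ (a δ) (b δ) (⋃ j : Fin N, A j) := measure_mono hsub
    _ ≤ ∑ j : Fin N, law D.carrier δ (a δ) (b δ) (A j) := measure_iUnion_fintype_le _ _
    _ ≤ ∑ _j : Fin N, ENNReal.ofReal (K * (r / R') ^ lam) := Finset.sum_le_sum fun j _ => hH1j j
    _ = N * ENNReal.ofReal (K * (r / R') ^ lam) := by
        rw [Finset.sum_const, Finset.card_univ, Fintype.card_fin, nsmul_eq_mul]
    _ = ENNReal.ofReal (N * (K * (r / R') ^ lam)) := by
        rw [ENNReal.ofReal_mul (Nat.cast_nonneg N), ENNReal.ofReal_natCast]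
    _ ≤ ENNReal.ofReal ε := ENNReal.ofReal_le_ofReal hbound

end Summit.CriticalPhenomena.SAWScalingLimit.Theorems.FKGToTraversalBound.SlitNecklace

end
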